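import Literature.Analysis.FluidPDE.DriftHeatKernelWindow
import Mathlib.Analysis.Calculus.BumpFunction.FiniteDimension
import Mathlib.Analysis.Calculus.BumpFunction.Normed
import Mathlib.MeasureTheory.Measure.Lebesgue.VolumeOfBalls
import HarnessLib

/-!
# Route SelfMixingDichotomy — crux `MixingPayoff`, line `birth`: the drift–heat bump floor (F3)

Support file (`--supports stmt-NavierStokesRegularity-1422`) for the crux
`Summit.NavierStokesRegularity.NavierStokesRegularity.Theses.SelfMixingDichotomy.MixingPayoff`,
line `birth`, stub `stub_driftHeatBumpFloor` (F3, the quantitative Gaussian floor for the local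
drift–heat class). There is no Navier–Stokes content here: the statement is a direct corollary
of the PROVED Gaussian lower bound `IsDriftHeatSolutionOn.kernel_lower_bound`
(`Literature/Analysis/FluidPDE/DriftHeatKernelLowerBound`) with the explicit profiles
`kSubLow`, `gaussTail`, `dkTilt` of `DriftHeatGaussianBounds`.

**Statement.** For every `K > 0` there is `λ = λ(K) > 0` such that: if `θ ≥ 0` is a member of
`IsDriftHeatSolutionOn a θ (√2 K / r) S U` on the window `S = [T - r², T - r²/2]` over an open
`U ⊇ B̄(x₀, (3 + 8K) r)`, and `θ(T - r²) = 1` on `B̄(x₀, r/2)`, then `θ(T - r²/2) ≥ λ` on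
`B̄(x₀, r/2)`.

**Proof.** `kernel_lower_bound` with centre `x₀`, `r_s = r_e = r/2`, `ρ = (3 + 8K) r`,
`t_b = T − r²`, `t_T = t = T − r²/2` (age `σ = r²/2`), drift bound `A = √2 K / r`, and weight
`h` = the `ContDiffBump x₀` with `rIn = r/4`, `rOut = r/2` (continuous, values in `[0, 1]`,
`tsupport = B̄(x₀, r/2)`, so `h ≤ θ(T − r²)` on `B̄(x₀, ρ)`;
`∫ h ≥ |B̄(x₀, r/4)| = (r/4)³ |B̄₁|` by `ContDiffBump.measure_closedBall_le_integral`).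
Room: `2·3·(r²/2) = 3r² < ((5/2 + 8K) r)²`. At age `r²/2`:
`dkTilt 3 A r (r²/2) ≤ 15K + 2K²` (`√(3r²/2) ≤ 2r`, `√(r²/2) ≤ r`, `√2 ≤ 3/2`, `(√2)² = 2`),
so `r³ · kSubLow ≥ (2π)^{-3/2} e^{-1/2 - 15K - 2K²}` while
`r³ · gaussTail 3 ((5/2 + 8K) r) (r²/2) = (2π)^{-3/2} e^{-(5/2 + 8K)²/2} ≤ (r³ · kSubLow)/2`
(`(5/2 + 8K)²/2 − 1/2 − 15K − 2K² ≥ 21/8 ≥ 1` and `2 ≤ e^x` for `x ≥ 1`); the powers of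
`r` cancel (`pow_mul_heatNorm_scale` of `DriftHeatKernelWindow`,
`Measure.addHaar_real_closedBall'`, `finrank_euclideanSpace_fin`), giving
`λ = |B̄₁|/64 · (2π)^{-3/2} e^{-1/2 - 15K - 2K²}/2`.

No named fact is taken as a hypothesis: the theorem is unconditional.

## References

* G. M. Lieberman, *Second Order Parabolic Differential Equations*, World Scientific (1996),
  Ch. VI §6 Theorem 6.18, Corollary 6.24 (Gaussian-comparison lower bound), as proved in the
  tree (`IsDriftHeatSolutionOn.kernel_lower_bound`).
-/

noncomputable section

open Literature.Analysis.FluidPDE MeasureTheory Set Function Metric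
open scoped ContDiff

-- `Summit = Problem` for this summit; the tree lakefile sets `weak.linter.dupNamespace = false`,
-- made explicit here for out-of-tree `lean check`.
set_option linter.dupNamespace false

namespace Summit.NavierStokesRegularity.NavierStokesRegularity.Theorems

local notation "E3" => EuclideanSpace ℝ (Fin 3)

/-! ### The explicit profile at the parabolic age `σ = r²/2` -/

/-- **Tilt bound at the parabolic age.** With drift bound `A = √2 K / r`, radius `D = r` and age
`σ = r²/2`: `dkTilt 3 A r (r²/2) = A√(3r²/2) + 8A√(r²/2) + A² r² ≤ 15K + 2K²`
(`√(3r²/2) ≤ 2r`, `√(r²/2) ≤ r`, `√2 ≤ 3/2`, `(√2)² = 2`). -/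
theorem driftHeatBumpFloor_dkTilt_le {K r : ℝ} (hK : 0 ≤ K) (hr : 0 < r) :
    dkTilt 3 (Real.sqrt 2 * K / r) r (r ^ 2 / 2) ≤ 15 * K + 2 * K ^ 2 := by
  unfold dkTilt
  have hs0 : 0 ≤ Real.sqrt 2 := Real.sqrt_nonneg 2
  have hs2 : Real.sqrt 2 ^ 2 = 2 := Real.sq_sqrt (by norm_num)
  have hs32 : Real.sqrt 2 ≤ 3 / 2 := by
    rw [Real.sqrt_le_left (by norm_num)]
    norm_num
  have h1 : Real.sqrt (r ^ 2 + r ^ 2 / 2) ≤ 2 * r := by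
    rw [Real.sqrt_le_left (by positivity)]
    nlinarith [sq_nonneg r]
  have h2 : Real.sqrt (r ^ 2 / 2) ≤ r := by
    rw [Real.sqrt_le_left hr.le]
    nlinarith [sq_nonneg r]
  set s : ℝ := Real.sqrt 2 with hs
  set A : ℝ := s * K / r with hA_def
  have hA : 0 ≤ A := by positivity
  have hAr : A * r = s * K := by
    rw [hA_def]
    field_simp
  have e1 : A * Real.sqrt (r ^ 2 + r ^ 2 / 2) ≤ A * (2 * r) := mul_le_mul_of_nonneg_left h1 hA
  have e2 : 2 * (3 + 1) * A * Real.sqrt (r ^ 2 / 2) ≤ 2 * (3 + 1) * A * r :=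
    mul_le_mul_of_nonneg_left h2 (by positivity)
  have e3 : 2 * A ^ 2 * (r ^ 2 / 2) = 2 * K ^ 2 := by
    calc 2 * A ^ 2 * (r ^ 2 / 2) = (A * r) ^ 2 := by ring
      _ = (s * K) ^ 2 := by rw [hAr]
      _ = 2 * K ^ 2 := by rw [mul_pow, hs2]
  have hsK : s * K ≤ 3 / 2 * K := mul_le_mul_of_nonneg_right hs32 hK
  have e1' : A * (2 * r) = 2 * (s * K) := by rw [← hAr]; ring
  have e2' : 2 * (3 + 1) * A * r = 8 * (s * K) := by rw [← hAr]; ring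
  linarith [e1, e2, e3, e1', e2', hsK]

/-- **The bulk profile at the parabolic age, rescaled.**
`r³ · kSubLow 3 (√2K/r) r (r²/2) = (2π)^{-3/2} e^{-1/2} e^{-dkTilt 3 (√2K/r) r (r²/2)}`
(`4π · r²/2 = 2π r²`, `r²/(4 · r²/2) = 1/2`, `r³ (2π r²)^{-3/2} = (2π)^{-3/2}` by
`pow_mul_heatNorm_scale`). -/
theorem driftHeatBumpFloor_cube_mul_kSubLow {K r : ℝ} (hr : 0 < r) :
    r ^ 3 * kSubLow 3 (Real.sqrt 2 * K / r) r (r ^ 2 / 2) =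
      (2 * Real.pi) ^ (-(3 : ℝ) / 2) * Real.exp (-(1 / 2)) *
        Real.exp (-dkTilt 3 (Real.sqrt 2 * K / r) r (r ^ 2 / 2)) := by
  have hN := pow_mul_heatNorm_scale 3 hr (by norm_num : (0 : ℝ) < 1 / 2)
  simp only [Nat.cast_ofNat] at hN
  rw [show (4 : ℝ) * Real.pi * (1 / 2) = 2 * Real.pi by ring] at hN
  have e1 : -r ^ 2 / (4 * (r ^ 2 / 2)) = -(1 / 2 : ℝ) := by
    rw [div_eq_iff (by positivity : (4 : ℝ) * (r ^ 2 / 2) ≠ 0)]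
    ring
  unfold kSubLow
  rw [show (4 : ℝ) * Real.pi * (r ^ 2 / 2) = 4 * Real.pi * (1 / 2 * r ^ 2) by ring, e1, ← hN]
  ring

/-- **The tail profile at the parabolic age, rescaled.**
`r³ · gaussTail 3 ((3 + 8K) r − r/2) (r²/2) = (2π)^{-3/2} e^{-(5/2 + 8K)²/2}`. -/
theorem driftHeatBumpFloor_cube_mul_gaussTail {K r : ℝ} (hr : 0 < r) :
    r ^ 3 * gaussTail 3 ((3 + 8 * K) * r - r / 2) (r ^ 2 / 2) =
      (2 * Real.pi) ^ (-(3 : ℝ) / 2) * Real.exp (-((5 / 2 + 8 * K) ^ 2 / 2)) := by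
  have hN := pow_mul_heatNorm_scale 3 hr (by norm_num : (0 : ℝ) < 1 / 2)
  simp only [Nat.cast_ofNat] at hN
  rw [show (4 : ℝ) * Real.pi * (1 / 2) = 2 * Real.pi by ring] at hN
  have e2 : -((3 + 8 * K) * r - r / 2) ^ 2 / (4 * (r ^ 2 / 2)) = -((5 / 2 + 8 * K) ^ 2 / 2) := by
    field_simp
    ring
  unfold gaussTail
  rw [show (4 : ℝ) * Real.pi * (r ^ 2 / 2) = 4 * Real.pi * (1 / 2 * r ^ 2) by ring, e2, ← hN]
  ring

/-- **The tail is at most half the bulk** (the numerical heart):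
`2 e^{-(5/2 + 8K)²/2} ≤ e^{-1/2 − (15K + 2K²)}` for `K ≥ 0`, since the difference of the
exponents is `21/8 + 5K + 30K² ≥ 1` and `2 ≤ 1 + x ≤ eˣ` for `x ≥ 1`. -/
theorem driftHeatBumpFloor_two_mul_exp_le {K : ℝ} (hK : 0 ≤ K) :
    2 * Real.exp (-((5 / 2 + 8 * K) ^ 2 / 2)) ≤ Real.exp (-(1 / 2) - (15 * K + 2 * K ^ 2)) := by
  have h1 : (2 : ℝ) ≤ Real.exp ((5 / 2 + 8 * K) ^ 2 / 2 - 1 / 2 - (15 * K + 2 * K ^ 2)) := by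
    have := Real.add_one_le_exp ((5 / 2 + 8 * K) ^ 2 / 2 - 1 / 2 - (15 * K + 2 * K ^ 2))
    nlinarith [sq_nonneg K]
  calc 2 * Real.exp (-((5 / 2 + 8 * K) ^ 2 / 2))
      ≤ Real.exp ((5 / 2 + 8 * K) ^ 2 / 2 - 1 / 2 - (15 * K + 2 * K ^ 2)) *
          Real.exp (-((5 / 2 + 8 * K) ^ 2 / 2)) :=
        mul_le_mul_of_nonneg_right h1 (Real.exp_pos _).le
    _ = Real.exp (-(1 / 2) - (15 * K + 2 * K ^ 2)) := by
        rw [← Real.exp_add]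
        congr 1
        ring

/-- **Scale-free floor of the Gaussian profile of `kernel_lower_bound` at the parabolic age.**
For `K ≥ 0`, `r > 0`: `(2π)^{-3/2} e^{-1/2 − (15K + 2K²)} / 2 ≤
r³ (kSubLow 3 (√2K/r) r (r²/2) − gaussTail 3 ((3+8K)r − r/2) (r²/2))`. -/
theorem driftHeatBumpFloor_profile_floor {K r : ℝ} (hK : 0 ≤ K) (hr : 0 < r) :
    (2 * Real.pi) ^ (-(3 : ℝ) / 2) * Real.exp (-(1 / 2) - (15 * K + 2 * K ^ 2)) / 2 ≤
      r ^ 3 * (kSubLow 3 (Real.sqrt 2 * K / r) r (r ^ 2 / 2) -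
        gaussTail 3 ((3 + 8 * K) * r - r / 2) (r ^ 2 / 2)) := by
  rw [mul_sub, driftHeatBumpFloor_cube_mul_kSubLow hr, driftHeatBumpFloor_cube_mul_gaussTail hr]
  have htilt := driftHeatBumpFloor_dkTilt_le hK hr
  have hg := driftHeatBumpFloor_two_mul_exp_le hK
  set c : ℝ := (2 * Real.pi) ^ (-(3 : ℝ) / 2) with hc_def
  have hc : 0 < c := by positivity
  have hk : c * Real.exp (-(1 / 2) - (15 * K + 2 * K ^ 2)) ≤
      c * Real.exp (-(1 / 2)) * Real.exp (-dkTilt 3 (Real.sqrt 2 * K / r) r (r ^ 2 / 2)) := by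
    rw [mul_assoc, ← Real.exp_add]
    exact mul_le_mul_of_nonneg_left (Real.exp_le_exp.2 (by linarith)) hc.le
  have hg2 : 2 * (c * Real.exp (-((5 / 2 + 8 * K) ^ 2 / 2))) ≤
      c * Real.exp (-(1 / 2) - (15 * K + 2 * K ^ 2)) := by
    calc 2 * (c * Real.exp (-((5 / 2 + 8 * K) ^ 2 / 2)))
        = c * (2 * Real.exp (-((5 / 2 + 8 * K) ^ 2 / 2))) := by ring
      _ ≤ c * Real.exp (-(1 / 2) - (15 * K + 2 * K ^ 2)) := mul_le_mul_of_nonneg_left hg hc.le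
  linarith [hk, hg2]

/-! ### The stub -/

/-- **Stub F3 — the quantitative Gaussian floor for the local drift–heat class.** For every
`K > 0` there is `λ = λ(K) > 0` (here `λ = |B̄₁|/64 · (2π)^{-3/2} e^{-1/2 - 15K - 2K²}/2`,
`|B̄₁|` the volume of the closed unit ball of `ℝ³`) such that: if `θ ≥ 0` on the window is a
member of `IsDriftHeatSolutionOn a θ (√2 K / r) S U` on `S = [T - r², T - r²/2]` over an open
`U ⊇ B̄(x₀, (3 + 8K) r)`, and `θ(T - r²) = 1` on `B̄(x₀, r/2)`, then `θ(T - r²/2) ≥ λ` on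
`B̄(x₀, r/2)`. Proof: `IsDriftHeatSolutionOn.kernel_lower_bound` (Lieberman 1996 Ch. VI via
Gaussian comparison, PROVED in the tree) with centre `x₀`, `r_s = r_e = r/2`,
`ρ = (3 + 8K) r`, `t_b = T − r²`, `t = T − r²/2`, weight the `ContDiffBump x₀` with radii
`r/4 < r/2` (mass `≥ (r/4)³ |B̄₁|`), and the scale-free profile floor
`driftHeatBumpFloor_profile_floor`. -/
theorem stub_driftHeatBumpFloor :
    ∀ K : ℝ, 0 < K → ∃ lam : ℝ, 0 < lam ∧
    ∀ (a : ℝ → E3 → E3) (θ : ℝ → E3 → ℝ) (x₀ : E3) (T r : ℝ), 0 < r →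
    ∀ U : Set E3, IsOpen U → Metric.closedBall x₀ ((3 + 8 * K) * r) ⊆ U →
    IsDriftHeatSolutionOn a θ (Real.sqrt 2 * K / r) (Set.Icc (T - r ^ 2) (T - r ^ 2 / 2)) U →
    (∀ t ∈ Set.Icc (T - r ^ 2) (T - r ^ 2 / 2), ∀ x : E3, 0 ≤ θ t x) →
    (∀ x ∈ Metric.closedBall x₀ (r / 2), θ (T - r ^ 2) x = 1) →
    ∀ x ∈ Metric.closedBall x₀ (r / 2), lam ≤ θ (T - r ^ 2 / 2) x := by
  intro K hK
  -- the constant: unit-ball volume times the scale-free profile floor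
  set V₁ : ℝ := (volume : Measure E3).real (closedBall (0 : E3) 1) with hV₁
  have hV₁0 : 0 < V₁ := by
    rw [hV₁, measureReal_def]
    exact ENNReal.toReal_pos (measure_closedBall_pos volume _ one_pos).ne'
      measure_closedBall_lt_top.ne
  set c₀ : ℝ := (2 * Real.pi) ^ (-(3 : ℝ) / 2) * Real.exp (-(1 / 2) - (15 * K + 2 * K ^ 2)) / 2
    with hc₀
  have hc₀0 : 0 < c₀ := by positivity
  refine ⟨V₁ / 64 * c₀, by positivity, ?_⟩
  intro a θ x₀ T r hr U hU hBU hsol hθ0 hθ1 x hx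
  have hA : 0 ≤ Real.sqrt 2 * K / r := by positivity
  have htb : T - r ^ 2 < T - r ^ 2 / 2 := by nlinarith
  have hKr : 0 < K * r := mul_pos hK hr
  -- the bump weight
  let φ : ContDiffBump x₀ := ⟨r / 4, r / 2, by positivity, by linarith⟩
  have hφs : tsupport (φ : E3 → ℝ) ⊆ closedBall x₀ (r / 2) := φ.tsupport_eq.le
  have hφu : ∀ y ∈ closedBall x₀ ((3 + 8 * K) * r), φ y ≤ θ (T - r ^ 2) y := by
    intro y _
    by_cases hy : y ∈ closedBall x₀ (r / 2)
    · rw [hθ1 y hy]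
      exact φ.le_one
    · rw [mem_closedBall, not_le] at hy
      rw [φ.zero_of_le_dist hy.le]
      exact hθ0 _ ⟨le_rfl, htb.le⟩ y
  -- room for the tail correction: `2·3·(r²/2) < ((5/2 + 8K) r)²`
  have hroom : 2 * (Module.finrank ℝ E3 : ℝ) * (T - r ^ 2 / 2 - (T - r ^ 2)) <
      ((3 + 8 * K) * r - r / 2) ^ 2 := by
    rw [finrank_euclideanSpace_fin, Nat.cast_ofNat,
      show (2 : ℝ) * 3 * (T - r ^ 2 / 2 - (T - r ^ 2)) = 3 * r ^ 2 by ring,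
      show ((3 + 8 * K) * r - r / 2) ^ 2 = (5 / 2 + 8 * K) ^ 2 * r ^ 2 by ring]
    have h3 : (3 : ℝ) < (5 / 2 + 8 * K) ^ 2 := by nlinarith
    exact mul_lt_mul_of_pos_right h3 (by positivity)
  -- the Gaussian lower bound by the earlier local mass
  have key := hsol.kernel_lower_bound hU hA (c := x₀) (ρ := (3 + 8 * K) * r) (rs := r / 2)
    (re := r / 2) (t_b := T - r ^ 2) (t_T := T - r ^ 2 / 2) (by positivity) (by nlinarith)
    (by nlinarith) Subset.rfl hBU hroom (fun t ht y _ => hθ0 t ht y) φ.continuous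
    (fun _ => φ.nonneg) hφs hφu (T - r ^ 2 / 2) ⟨htb, le_rfl⟩ x hx
  rw [finrank_euclideanSpace_fin, Nat.cast_ofNat, add_halves,
    show T - r ^ 2 / 2 - (T - r ^ 2) = r ^ 2 / 2 by ring] at key
  -- mass of the weight
  have hmass : (r / 4) ^ 3 * V₁ ≤ ∫ z, φ z := by
    have h2 := φ.measure_closedBall_le_integral (μ := (volume : Measure E3))
    have h3 : (volume : Measure E3).real (closedBall x₀ (r / 4)) = (r / 4) ^ 3 * V₁ := by
      rw [Measure.addHaar_real_closedBall' volume x₀ (by positivity : (0 : ℝ) ≤ r / 4),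
        finrank_euclideanSpace_fin]
    rw [← h3]
    exact h2
  -- the scale-free profile floor
  have hprof := driftHeatBumpFloor_profile_floor hK.le hr
  rw [← hc₀] at hprof
  have hr3 : 0 < r ^ 3 := by positivity
  have hprof' : c₀ * (r ^ 3)⁻¹ ≤ kSubLow 3 (Real.sqrt 2 * K / r) r (r ^ 2 / 2) -
      gaussTail 3 ((3 + 8 * K) * r - r / 2) (r ^ 2 / 2) := by
    calc c₀ * (r ^ 3)⁻¹ = (r ^ 3)⁻¹ * c₀ := mul_comm _ _
      _ ≤ (r ^ 3)⁻¹ * (r ^ 3 * (kSubLow 3 (Real.sqrt 2 * K / r) r (r ^ 2 / 2) -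
          gaussTail 3 ((3 + 8 * K) * r - r / 2) (r ^ 2 / 2))) :=
        mul_le_mul_of_nonneg_left hprof (inv_nonneg.2 hr3.le)
      _ = _ := by rw [← mul_assoc, inv_mul_cancel₀ hr3.ne', one_mul]
  have hr0 : r ≠ 0 := hr.ne'
  calc V₁ / 64 * c₀ = (r / 4) ^ 3 * V₁ * (c₀ * (r ^ 3)⁻¹) := by
        field_simp
        ring
    _ ≤ (∫ z, φ z) * (kSubLow 3 (Real.sqrt 2 * K / r) r (r ^ 2 / 2) -
          gaussTail 3 ((3 + 8 * K) * r - r / 2) (r ^ 2 / 2)) :=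
        mul_le_mul hmass hprof' (by positivity) (integral_nonneg fun _ => φ.nonneg)
    _ ≤ θ (T - r ^ 2 / 2) x := key

end Summit.NavierStokesRegularity.NavierStokesRegularity.Theorems

end
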